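import Literature.IUT.LogVolume.CompletionLocalFieldsUnramified
import HarnessLib

/-!
# [IUTchIV] Theorem 1.10, Step (iii) (R1)–(R4) and Step (v) "`4(j+1)·ι·l*_mod`": the ramification bounds
# for the GENUINE completions `K_{v̲}` (proof-only; abc-iut cell, campaign S, seat abc-iut-S1)

Mochizuki, *Inter-universal Teichmüller theory IV* (RIMS manuscript Apr. 2020 = PRIMS **57** (2021)), proof of
Theorem 1.10, Step (iii), kurims p. 25 l.−8 – p. 26 l. 3 (read on the page):

  "(R1) `log(e_v) ≤ log(2^11·3^3·5·e_mod·l^4)` if `v` divides `l`,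
   (R2) `log(e_v) ≤ log(2^11·3^3·5·e_mod·l)` if `v` divides `2·3·5` or lies in `Supp(𝔮)` [hence does not
        divide `l`],
   (R3) `log(e_v) ≤ log(2^11·3^3·5·e_mod)` if `v` does not divide `2·3·5·l` and, moreover, is not contained
        in `Supp(𝔮)`, and hence that
   (R4) if `e_v ≥ p_v − 1 > p_v − 2`, then `p_v ≤ 2^12·3^3·5·e_mod·l = e*_mod·l`, and
        `log(e_v) ≤ −3 + 4·log(e*_mod·l)`
   — cf. (E3), (E4), (E5), (E6); (D0); Proposition 1.8, (v), (vii); [IUTchI], Definition 3.1, (c)."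

and Step (v), p. 28 l. 12–16: "by (R4), if `e_{v_i} > p_{v_ℚ} − 2` for some `i ∈ I`, then it follows that
`p_{v_ℚ} ≤ e*_mod·l`, and `log(e_{v_i}) ≤ −3 + 4·log(e*_mod·l)`, so the upper bound in question may be taken
to be `(−λ + d_I + 1)·log(p) + 4(j+1)·l*_mod` — where we write `l*_mod := log(e*_mod·l)`"; p. 28 l.−9:
"`ι_{v_ℚ} = 1` if `p_{v_ℚ} ≤ e*_mod·l`, `ι_{v_ℚ} = 0` if `p_{v_ℚ} > e*_mod·l`".

Here `e_v` is the absolute ramification index of the completion `K_v` (`K = F(E_F[l])`, [IUTchI] Def. 3.1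
(c)), `e_mod` "the maximal ramification index of `F_mod` over `ℚ`" (Thm. 1.10, p. 22), `[F : F_mod] ≤
2^11·3^3·5` (`[F_tpd : F_mod] ≤ |GL₂(𝔽₂)| = 6`, `Gal(F/F_tpd) ↪ GL₂(𝔽₃) × GL₂(𝔽₅) × ℤ/2ℤ`, Step (ii) p. 24)
and `Gal(K/F) ↪ GL₂(𝔽_l)` (`[K : F] ∣ l(l−1)²(l+1)`, (E3)).

This file proves (R1)–(R4) for the GENUINE local fields of the cell's genuine Θ-volume inputs
(abc-iut-S2's `PlaceSection.localFieldFamily`: `K_{v̲} = RescaledCompletion K p v̲`, with abc-iut-S1's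
norm-defined `absRamificationIdx p K_{v̲} = e(v̲ | p)`, abc-iut-S7's `absRamificationIdx_rescaledCompletion`),
over a tower of number fields `F₀ ⊆ F ⊆ K` (`F₀` in the role of `F_mod`, so `[F : F₀] ≤ 2^11·3^3·5`), from the
PER-PLACE ramification input of Prop. 1.8 (vii) in GLOBAL currency — "`e(v̲ | v̲ ∩ F) ∣ l` at the places not
over `l`" (at good places `e = 1`, at multiplicative places `e ∣ l`: the tree's
`WeierstrassCurve.ramificationIdx_divisionField_eq_one_of_hasGoodReductionAt` /
`ramificationIdx_divisionField_dvd_of_hasMultiplicativeReductionAt`, abc-iut-S5; instantiated for the genuine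
theta tower by abc-iut-S-d1) — and the degree bound `[K : F] ∣ l(l−1)²(l+1)` (the tree's
`WeierstrassCurve.finrank_dvd_of_ker_galoisRepTorsion_le_fixingSubgroup`). The OUTPUT `R4_localFieldFamily` is
LITERALLY the hypothesis `hR4` of abc-iut-c312-d1's `Summit.ABC.IUTFork.DHData.logμ_hullUTheta_ofInput_le_collBoundMin`
/ `hwavg_ofInput` (LDHGenuineStepV, p416288), with `ι_p := (p ≤ 2^12·3^3·5·e_mod·l ? 1 : 0)` and
`l*_mod := log(2^12·3^3·5·e_mod·l)`:

* `three_add_log_le_four_mul_log` — the real-analysis of (R4): `1 ≤ e`, `21·e ≤ N^4 ⇒ 3 + log e ≤ 4·log N`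
  (`e^3 < 21`);
* `ramificationIdx_int_eq_mul_mul` — `e(u|p) = e(u ∩ F₀ | p)·e(u ∩ F | u ∩ F₀)·e(u | u ∩ F)` (transitivity of
  `e`, Mathlib `Ideal.ramificationIdx_tower`) and the bound `ramificationIdx_int_le` :
  `e(u|p) ≤ e_mod·[F:F₀]·e(u | u ∩ F)`;
* `ramificationIdx_int_le_R1` — **(R1)** `e(u|p) ≤ 2^11·3^3·5·e_mod·l^4` (any place; `e(u|u∩F) ≤ [K:F] ≤ l^4`);
* `ramificationIdx_int_le_R2` — **(R2)/(R3)** `e(u|p) ≤ 2^11·3^3·5·e_mod·l` at the places not over `l`;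
* `absRamificationIdx_localFieldFamily_eq` — `e(K_{v̲}) = e(v̲ | p)` for the genuine family;
  `ramificationIdx_int_le_finrank_rat` — `e(v | p) ≤ [F₀ : ℚ]` ("`e_mod ≤ d_mod`": `e_mod := d_mod` is admissible);
* `R4_localFieldFamily` — **(R4) in the consumer's shape**, with `l*_mod` written `Real.log (((2^12·3^3·5·e_mod : ℕ) : ℝ)·l)`
  as in abc-iut-S3's `Thm110Numerics.lstar` / `Cor22.display_of_squeeze`.

Proof-only companion (no definition, no named fact, no instance); classical algebraic number theory
(Neukirch *ANT* I (8.2), II (6.8)); TAKES NO SIDE on [IUTchIII] Cor. 3.12 — the IUT locators only record where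
the text prints these inequalities.
-/

noncomputable section

namespace Literature.IUT.LogVolume

open NumberField IsDedekindDomain Literature.NumberTheory.NumberFields

/-! ## The real-analysis of (R4) -/

/-- `e^3 < 21` (`e < 2.7182818286`). [folklore] -/
private theorem exp_three_lt_twentyOne : Real.exp 3 < 21 := by
  have h3 : Real.exp 3 = Real.exp 1 ^ 3 := by
    rw [← Real.exp_nat_mul]; norm_num
  rw [h3]
  have h0 : 0 ≤ Real.exp 1 := (Real.exp_pos 1).le
  calc Real.exp 1 ^ 3 < 2.7182818286 ^ 3 := by gcongr; exact Real.exp_one_lt_d9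
    _ < 21 := by norm_num

/-- The logarithmic step of (R4): if `1 ≤ e` and `21·e ≤ N^4`, then `3 + log(e) ≤ 4·log(N)` — so that
`log(e) ≤ −3 + 4·log(e*_mod·l)` once `21·e ≤ (e*_mod·l)^4`. [cite: Mochizuki2012, IUTchIV Thm 1.10 proof Step (iii) (R4) p.26] -/
theorem three_add_log_le_four_mul_log {e N : ℕ} (he : 1 ≤ e) (h : 21 * e ≤ N ^ 4) :
    3 + Real.log e ≤ 4 * Real.log N := by
  have he0 : (e : ℝ) ≠ 0 := by exact_mod_cast (by omega : e ≠ 0)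
  have h3 : (3 : ℝ) ≤ Real.log 21 := by
    rw [Real.le_log_iff_exp_le (by norm_num)]
    exact exp_three_lt_twentyOne.le
  calc 3 + Real.log e ≤ Real.log 21 + Real.log e := by linarith
    _ = Real.log ((21 * e : ℕ) : ℝ) := by
        push_cast
        rw [Real.log_mul (by norm_num) he0]
    _ ≤ Real.log ((N ^ 4 : ℕ) : ℝ) :=
        Real.log_le_log (by positivity) (by exact_mod_cast h)
    _ = 4 * Real.log N := by push_cast; rw [Real.log_pow]; norm_num

/-- The numerical heart of (R1)+(R4): `21·(2^11·3^3·5·m·l^4) ≤ (2^12·3^3·5·m·l)^4`.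
[cite: Mochizuki2012, IUTchIV Thm 1.10 proof Step (iii) (R4) p.26] -/
theorem twentyOne_mul_R1_le_pow (m l : ℕ) :
    21 * (2 ^ 11 * 3 ^ 3 * 5 * m * l ^ 4) ≤ (2 ^ 12 * 3 ^ 3 * 5 * m * l) ^ 4 := by
  have h1 : m ≤ m ^ 4 := Nat.le_self_pow (by norm_num) m
  calc 21 * (2 ^ 11 * 3 ^ 3 * 5 * m * l ^ 4) = (21 * (2 ^ 11 * 3 ^ 3 * 5)) * (m * l ^ 4) := by ring
    _ ≤ (2 ^ 12 * 3 ^ 3 * 5) ^ 4 * (m ^ 4 * l ^ 4) :=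
        Nat.mul_le_mul (by norm_num) (Nat.mul_le_mul_right _ h1)
    _ = (2 ^ 12 * 3 ^ 3 * 5 * m * l) ^ 4 := by ring

/-- The numerical heart of (R2)/(R3)+(R4): `21·(2^11·3^3·5·m·l) ≤ (2^12·3^3·5·m·l)^4`.
[cite: Mochizuki2012, IUTchIV Thm 1.10 proof Step (iii) (R4) p.26] -/
theorem twentyOne_mul_R2_le_pow (m l : ℕ) :
    21 * (2 ^ 11 * 3 ^ 3 * 5 * m * l) ≤ (2 ^ 12 * 3 ^ 3 * 5 * m * l) ^ 4 := by
  have h : 2 ^ 11 * 3 ^ 3 * 5 * m * l ≤ 2 ^ 11 * 3 ^ 3 * 5 * m * l ^ 4 :=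
    Nat.mul_le_mul_left _ (Nat.le_self_pow (by norm_num) l)
  exact (Nat.mul_le_mul_left 21 h).trans (twentyOne_mul_R1_le_pow m l)

/-- `|GL₂(𝔽_l)| = l(l−1)²(l+1) ≤ l^4`. [cite: Mochizuki2012, IUTchIV Thm 1.10 proof Step (i) (E3) p.24] -/
theorem card_GL_two_le_pow_four (l : ℕ) : l * (l - 1) ^ 2 * (l + 1) ≤ l ^ 4 := by
  rcases Nat.eq_zero_or_pos l with rfl | hl
  · simp
  · obtain ⟨m, rfl⟩ : ∃ m, l = m + 1 := ⟨l - 1, by omega⟩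
    rw [Nat.add_sub_cancel]
    have h : (m + 1) * m ^ 2 * (m + 1 + 1) + (m + 1) * (m ^ 2 + 3 * m + 1) = (m + 1) ^ 4 := by ring
    omega

/-- The `l`-part of `|GL₂(𝔽_l)|` is `l`: if `l` is prime and `e ∣ l(l−1)²(l+1)` with `e = l^k`, then `e ∣ l`.
[cite: Mochizuki2012, IUTchIV Thm 1.10 proof Step (i) (E3) p.24] -/
theorem dvd_prime_of_pow_dvd_card_GL_two {l e k : ℕ} (hl : l.Prime) (he : e = l ^ k)
    (hdvd : e ∣ l * (l - 1) ^ 2 * (l + 1)) : e ∣ l := by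
  subst he
  match k with
  | 0 => simp
  | 1 => simp
  | k + 2 =>
    exfalso
    have h' : l * l ∣ l * ((l - 1) ^ 2 * (l + 1)) := by
      have := (pow_dvd_pow l (by omega : 2 ≤ k + 2)).trans hdvd
      simpa [pow_two, mul_assoc] using this
    have h'' : l ∣ (l - 1) ^ 2 * (l + 1) := Nat.dvd_of_mul_dvd_mul_left hl.pos h'
    rcases (Nat.Prime.dvd_mul hl).mp h'' with h1 | h1
    · have h2 : l ∣ l - 1 := hl.dvd_of_dvd_pow h1
      have hlt : l - 1 < l := Nat.sub_lt hl.pos one_pos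
      have hpos : 0 < l - 1 := by have := hl.two_le; omega
      exact absurd (Nat.le_of_dvd hpos h2) (not_le.mpr hlt)
    · have h2 : l ∣ 1 := (Nat.dvd_add_right (dvd_refl l)).mp h1
      exact hl.one_lt.ne' (Nat.dvd_one.mp h2)

/-! ## Transitivity of `e` in the tower `ℚ ⊆ F₀ ⊆ F ⊆ K` -/

section Tower

variable {F₀ F K : Type} [Field F₀] [NumberField F₀] [Field F] [NumberField F] [Field K] [NumberField K]
  [Algebra F₀ F] [Algebra F K] [Algebra F₀ K] [IsScalarTower F₀ F K]

omit [NumberField F₀] [NumberField K] in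
/-- The rings of integers along `F₀ ⊆ K` have no zero smul-divisors. [folklore] -/
private theorem noZeroSMulDivisors_int (F₀ K : Type) [Field F₀] [Field K] [Algebra F₀ K] :
    NoZeroSMulDivisors (𝓞 F₀) (𝓞 K) :=
  ⟨fun {c x} h => by
    rw [Algebra.smul_def, mul_eq_zero] at h
    rcases h with h | h
    · exact Or.inl (RingOfIntegers.algebraMap.injective F₀ K (by rw [h, map_zero]))
    · exact Or.inr h⟩

omit [NumberField K] in
/-- **Transitivity of the ramification index** along `ℤ ⊆ 𝓞_{F₀} ⊆ 𝓞_F ⊆ 𝓞_K` for a nonzero prime `u` of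
`K`: `e(u | p) = e(u ∩ F₀ | p) · e(u ∩ F | u ∩ F₀) · e(u | u ∩ F)`. [cite: NeukirchANT1999, Ch. II Prop. (8.5) / Ch. I §8] -/
theorem ramificationIdx_int_eq_mul_mul (u : HeightOneSpectrum (𝓞 K)) :
    u.asIdeal.ramificationIdx ℤ =
      (u.asIdeal.under (𝓞 F₀)).ramificationIdx ℤ *
        ((u.asIdeal.under (𝓞 F)).ramificationIdx (𝓞 F₀) * u.asIdeal.ramificationIdx (𝓞 F)) := by
  haveI : (u.asIdeal.under (𝓞 F)).LiesOver (u.asIdeal.under (𝓞 F₀)) :=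
    ⟨(Ideal.under_under (B := 𝓞 F) u.asIdeal).symm⟩
  rw [Ideal.ramificationIdx_tower (R := ℤ) (u.asIdeal.under (𝓞 F₀)) u.asIdeal,
    Ideal.ramificationIdx_tower (R := 𝓞 F₀) (u.asIdeal.under (𝓞 F)) u.asIdeal]

/-- `e(u ∩ F | u ∩ F₀) ≤ [F : F₀]`. [cite: NeukirchANT1999, Ch. I Prop. (8.2)] -/
theorem ramificationIdx_under_le_finrank (u : HeightOneSpectrum (𝓞 K)) :
    (u.asIdeal.under (𝓞 F)).ramificationIdx (𝓞 F₀) ≤ Module.finrank F₀ F := by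
  haveI := noZeroSMulDivisors_int F₀ F
  haveI : (u.asIdeal.under (𝓞 F)).IsMaximal := Ideal.IsMaximal.under (𝓞 F) u.asIdeal
  haveI : (u.asIdeal.under (𝓞 F₀)).IsMaximal := Ideal.IsMaximal.under (𝓞 F₀) u.asIdeal
  haveI : (u.asIdeal.under (𝓞 F)).LiesOver (u.asIdeal.under (𝓞 F₀)) :=
    ⟨(Ideal.under_under (B := 𝓞 F) u.asIdeal).symm⟩
  have h0 : u.asIdeal.under (𝓞 F₀) ≠ ⊥ := mt Ideal.eq_bot_of_comap_eq_bot u.ne_bot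
  rw [← Ideal.ramificationIdx'_eq_ramificationIdx (u.asIdeal.under (𝓞 F₀)) (u.asIdeal.under (𝓞 F)) h0]
  exact Ideal.ramificationIdx_le_finrank (𝓞 F) F₀ F (u.asIdeal.under (𝓞 F)) (p := u.asIdeal.under (𝓞 F₀))

omit [NumberField F₀] [Algebra F₀ F] [Algebra F₀ K] [IsScalarTower F₀ F K] in
/-- `e(u | u ∩ F) ≤ [K : F]`. [cite: NeukirchANT1999, Ch. I Prop. (8.2)] -/
theorem ramificationIdx_rel_le_finrank (u : HeightOneSpectrum (𝓞 K)) :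
    u.asIdeal.ramificationIdx (𝓞 F) ≤ Module.finrank F K := by
  haveI := noZeroSMulDivisors_int F K
  haveI : (u.asIdeal.under (𝓞 F)).IsMaximal := Ideal.IsMaximal.under (𝓞 F) u.asIdeal
  have h0 : u.asIdeal.under (𝓞 F) ≠ ⊥ := mt Ideal.eq_bot_of_comap_eq_bot u.ne_bot
  rw [← Ideal.ramificationIdx'_eq_ramificationIdx (u.asIdeal.under (𝓞 F)) u.asIdeal h0]
  exact Ideal.ramificationIdx_le_finrank (𝓞 K) F K u.asIdeal (p := u.asIdeal.under (𝓞 F))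

/-- **The tower bound**: if `e(u ∩ F₀ | p) ≤ e_mod` then `e(u | p) ≤ e_mod · [F : F₀] · e(u | u ∩ F)`.
[cite: Mochizuki2012, IUTchIV Thm 1.10 proof Step (iii) (R1)–(R3) p.25] -/
theorem ramificationIdx_int_le (u : HeightOneSpectrum (𝓞 K)) {emod : ℕ}
    (hemod : (u.asIdeal.under (𝓞 F₀)).ramificationIdx ℤ ≤ emod) :
    u.asIdeal.ramificationIdx ℤ ≤ emod * Module.finrank F₀ F * u.asIdeal.ramificationIdx (𝓞 F) := by
  rw [ramificationIdx_int_eq_mul_mul (F₀ := F₀) (F := F) u, ← mul_assoc]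
  exact Nat.mul_le_mul_right _ (Nat.mul_le_mul hemod (ramificationIdx_under_le_finrank u))

/-- **(R1)**: `e(u | p) ≤ 2^11·3^3·5·e_mod·l^4` for EVERY nonzero prime `u` of `K`, from `e(u ∩ F₀ | p) ≤ e_mod`,
`[F : F₀] ≤ 2^11·3^3·5` and `[K : F] ∣ l(l−1)²(l+1) (≤ l^4)`. [cite: Mochizuki2012, IUTchIV Thm 1.10 proof Step (iii) (R1) p.25] -/
theorem ramificationIdx_int_le_R1 (u : HeightOneSpectrum (𝓞 K)) {emod l : ℕ}
    (hemod : (u.asIdeal.under (𝓞 F₀)).ramificationIdx ℤ ≤ emod)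
    (hF : Module.finrank F₀ F ≤ 2 ^ 11 * 3 ^ 3 * 5) (hl : 2 ≤ l)
    (hKF : Module.finrank F K ∣ l * (l - 1) ^ 2 * (l + 1)) :
    u.asIdeal.ramificationIdx ℤ ≤ 2 ^ 11 * 3 ^ 3 * 5 * emod * l ^ 4 := by
  have hK : u.asIdeal.ramificationIdx (𝓞 F) ≤ l ^ 4 := by
    refine (ramificationIdx_rel_le_finrank u).trans ((Nat.le_of_dvd ?_ hKF).trans (card_GL_two_le_pow_four l))
    have h1 : 0 < l - 1 := by omega
    positivity
  calc u.asIdeal.ramificationIdx ℤ ≤ emod * Module.finrank F₀ F * u.asIdeal.ramificationIdx (𝓞 F) :=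
        ramificationIdx_int_le u hemod
    _ ≤ emod * (2 ^ 11 * 3 ^ 3 * 5) * l ^ 4 := Nat.mul_le_mul (Nat.mul_le_mul_left _ hF) hK
    _ = 2 ^ 11 * 3 ^ 3 * 5 * emod * l ^ 4 := by ring

/-- **(R2)/(R3)**: `e(u | p) ≤ 2^11·3^3·5·e_mod·l` for a nonzero prime `u` of `K` at which `e(u | u ∩ F) ∣ l`
(the places not over `l`: unramified at good places, ramification index dividing `l` at multiplicative ones,
Prop. 1.8 (vii)). [cite: Mochizuki2012, IUTchIV Thm 1.10 proof Step (iii) (R2)(R3) p.25] -/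
theorem ramificationIdx_int_le_R2 (u : HeightOneSpectrum (𝓞 K)) {emod l : ℕ}
    (hemod : (u.asIdeal.under (𝓞 F₀)).ramificationIdx ℤ ≤ emod)
    (hF : Module.finrank F₀ F ≤ 2 ^ 11 * 3 ^ 3 * 5) (hl : l ≠ 0)
    (htame : u.asIdeal.ramificationIdx (𝓞 F) ∣ l) :
    u.asIdeal.ramificationIdx ℤ ≤ 2 ^ 11 * 3 ^ 3 * 5 * emod * l := by
  calc u.asIdeal.ramificationIdx ℤ ≤ emod * Module.finrank F₀ F * u.asIdeal.ramificationIdx (𝓞 F) :=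
        ramificationIdx_int_le u hemod
    _ ≤ emod * (2 ^ 11 * 3 ^ 3 * 5) * l :=
        Nat.mul_le_mul (Nat.mul_le_mul_left _ hF) (Nat.le_of_dvd (Nat.pos_of_ne_zero hl) htame)
    _ = 2 ^ 11 * 3 ^ 3 * 5 * emod * l := by ring

omit [NumberField F₀] [NumberField F] [NumberField K] [Algebra F₀ F] [Algebra F₀ K]
  [IsScalarTower F₀ F K] in
/-- Two distinct rational primes cannot lie in one nonzero prime `u` of `K` (`u ∩ ℤ = (p)` is a prime ideal):
if `p ∈ u` and `l ≠ p` is prime, then `l ∉ u ∩ 𝓞_F`. [cite: NeukirchANT1999, Ch. I §8 (𝔓 ∩ 𝓞 = 𝔭, primes lying over)] -/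
theorem natCast_not_mem_under_of_ne (u : HeightOneSpectrum (𝓞 K)) {p l : ℕ} (hp : p.Prime) (hl : l.Prime)
    (hpu : ((p : ℕ) : 𝓞 K) ∈ u.asIdeal) (hne : p ≠ l) : ((l : ℕ) : 𝓞 F) ∉ u.asIdeal.under (𝓞 F) := by
  intro hlu
  rw [Ideal.under_def, Ideal.mem_comap, map_natCast] at hlu
  have hcop : IsCoprime (p : ℤ) (l : ℤ) :=
    Nat.isCoprime_iff_coprime.mpr ((Nat.coprime_primes hp hl).mpr hne)
  obtain ⟨a, b, hab⟩ := hcop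
  apply u.isPrime.ne_top
  rw [Ideal.eq_top_iff_one]
  have h : ((a * p + b * l : ℤ) : 𝓞 K) ∈ u.asIdeal := by
    push_cast
    exact u.asIdeal.add_mem (u.asIdeal.mul_mem_left _ hpu) (u.asIdeal.mul_mem_left _ hlu)
  rwa [hab, Int.cast_one] at h

end Tower

/-- `e(v | p) ≤ [F₀ : ℚ]`: the printed "`(1 ≤) e_mod (≤ d_mod)`" (Thm. 1.10, p. 22) — any `e_mod` between the
maximal ramification index of `F₀ = F_mod` over `ℚ` and `d_mod = [F_mod : ℚ]` satisfies the hypothesis `hemod`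
below; in particular `e_mod := d_mod` does. [cite: Mochizuki2012, IUTchIV Thm 1.10 p.22] -/
theorem ramificationIdx_int_le_finrank_rat {F₀ : Type} [Field F₀] [NumberField F₀]
    (v : HeightOneSpectrum (𝓞 F₀)) :
    v.asIdeal.ramificationIdx ℤ ≤ Module.finrank ℚ F₀ := by
  haveI : (v.asIdeal.under ℤ).IsMaximal := Ideal.IsMaximal.under ℤ v.asIdeal
  have h0 : v.asIdeal.under ℤ ≠ ⊥ := mt Ideal.eq_bot_of_comap_eq_bot v.ne_bot
  rw [← Ideal.ramificationIdx'_eq_ramificationIdx (v.asIdeal.under ℤ) v.asIdeal h0]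
  exact Ideal.ramificationIdx_le_finrank (𝓞 F₀) ℚ F₀ v.asIdeal (p := v.asIdeal.under ℤ)

/-! ## (R4) for the genuine local field family -/

namespace PlaceSection

variable {F₀ K : Type} [Field F₀] [NumberField F₀] [Field K] [NumberField K] [Algebra F₀ K]
  (σ : PlaceSection F₀ K)

/-- **`e(K_{v̲}) = e(v̲ | p)`** for the genuine completion at `v̲ = σ.lift v`, `v ∈ V(F₀)_p` (the member
`σ.localFieldFamily p hp` of the family consumed by `DHData.ofInput`). [cite: NeukirchANT1999, Ch. II Prop. (6.8)] -/
theorem absRamificationIdx_localFieldFamily_eq {p : ℕ} [hp : Fact p.Prime] (v : placesOver F₀ p) :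
    absRamificationIdx p ((σ.localFieldFamily p hp.out).k v) = (σ.lift v.1).asIdeal.ramificationIdx ℤ :=
  absRamificationIdx_rescaledCompletion K p (σ.lift v.1) (σ.natCast_mem_lift v)

omit [NumberField F₀] [NumberField K] in
/-- `e(v̲ ∩ F₀ | p) = e(v | p)`: the place under `v̲` IS `v`. [cite: NeukirchANT1999, Ch. I §8] -/
theorem ramificationIdx_under_lift_eq (v : HeightOneSpectrum (𝓞 F₀)) :
    ((σ.lift v).asIdeal.under (𝓞 F₀)).ramificationIdx ℤ = v.asIdeal.ramificationIdx ℤ := by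
  rw [σ.under_asIdeal_lift v]

variable {F : Type} [Field F] [NumberField F] [Algebra F₀ F] [Algebra F K] [IsScalarTower F₀ F K]

/-- **(R4) for the genuine completions, in the shape consumed by the L-DH Step (v) file** (abc-iut-c312-d1's
`DHData.logμ_hullUTheta_ofInput_le_collBoundMin`, hypothesis `hR4`): for `v ∈ V(F₀)_p` with `e(v|p) ≤ e_mod`
(`1 ≤ e_mod`), an intermediate field `F` with `[F : F₀] ≤ 2^11·3^3·5`, a prime `l` with `[K : F] ∣ l(l−1)²(l+1)`,
and the Prop. 1.8 (vii) input "`e(v̲ | v̲ ∩ F) ∣ l` if `v̲ ∤ l`":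
`p − 2 < e(K_{v̲}) ⟹ 3 + log e(K_{v̲}) ≤ 4·ι_p·l*_mod`, `ι_p = 1` if `p ≤ e*_mod·l` and `0` otherwise,
`e*_mod = 2^12·3^3·5·e_mod`, `l*_mod = log(e*_mod·l)`. (If `p ≤ e*_mod·l`: (R1)/(R2) give `21·e ≤ (e*_mod·l)^4`;
if `p > e*_mod·l` then `v̲ ∤ l` and (R2)/(R3) give `e ≤ e*_mod·l/2 < p − 2`, so the premise is void.)
[cite: Mochizuki2012, IUTchIV Thm 1.10 proof Step (iii) (R4) p.26] [cite: Mochizuki2012, IUTchIV Thm 1.10 proof Step (v) p.28] -/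
theorem R4_localFieldFamily {p : ℕ} [hp : Fact p.Prime] (v : placesOver F₀ p) {emod l : ℕ}
    (hemod1 : 1 ≤ emod) (hemod : v.1.asIdeal.ramificationIdx ℤ ≤ emod)
    (hF : Module.finrank F₀ F ≤ 2 ^ 11 * 3 ^ 3 * 5) (hl : l.Prime)
    (hKF : Module.finrank F K ∣ l * (l - 1) ^ 2 * (l + 1))
    (htame : ((l : ℕ) : 𝓞 F) ∉ (σ.lift v.1).asIdeal.under (𝓞 F) →
      (σ.lift v.1).asIdeal.ramificationIdx (𝓞 F) ∣ l) :
    p - 2 < absRamificationIdx p ((σ.localFieldFamily p hp.out).k v) →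
      3 + Real.log (absRamificationIdx p ((σ.localFieldFamily p hp.out).k v)) ≤
        4 * (if p ≤ 2 ^ 12 * 3 ^ 3 * 5 * emod * l then (1 : ℝ) else 0) *
          Real.log (((2 ^ 12 * 3 ^ 3 * 5 * emod : ℕ) : ℝ) * l) := by
  intro hlt
  have hcast : (((2 ^ 12 * 3 ^ 3 * 5 * emod : ℕ) : ℝ) * l) = ((2 ^ 12 * 3 ^ 3 * 5 * emod * l : ℕ) : ℝ) := by
    push_cast; ring
  rw [hcast]
  rw [σ.absRamificationIdx_localFieldFamily_eq v] at hlt ⊢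
  set u : HeightOneSpectrum (𝓞 K) := σ.lift v.1 with hu
  have hemod' : (u.asIdeal.under (𝓞 F₀)).ramificationIdx ℤ ≤ emod := by
    rw [hu, σ.ramificationIdx_under_lift_eq v.1]; exact hemod
  have he1 : 1 ≤ u.asIdeal.ramificationIdx ℤ := Ideal.ramificationIdx_pos _ _
  have hpu : ((p : ℕ) : 𝓞 K) ∈ u.asIdeal := σ.natCast_mem_lift v
  -- (R2)/(R3) at the places not over `l`
  have hR2 : p ≠ l → u.asIdeal.ramificationIdx ℤ ≤ 2 ^ 11 * 3 ^ 3 * 5 * emod * l := fun hne =>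
    ramificationIdx_int_le_R2 (F₀ := F₀) (F := F) u hemod' hF hl.ne_zero
      (htame (natCast_not_mem_under_of_ne (F := F) u hp.out hl hpu hne))
  by_cases hι : p ≤ 2 ^ 12 * 3 ^ 3 * 5 * emod * l
  · -- `ι_p = 1`: `21·e ≤ (e*_mod·l)^4` by (R1) (over `l`) or (R2)/(R3) (off `l`)
    rw [if_pos hι, mul_one]
    refine three_add_log_le_four_mul_log he1 ?_
    by_cases hpl : p = l
    · exact (Nat.mul_le_mul_left 21
        (ramificationIdx_int_le_R1 (F₀ := F₀) (F := F) u hemod' hF hl.two_le hKF)).trans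
        (twentyOne_mul_R1_le_pow emod l)
    · exact (Nat.mul_le_mul_left 21 (hR2 hpl)).trans (twentyOne_mul_R2_le_pow emod l)
  · -- `ι_p = 0`: then `p > e*_mod·l ≥ l`, so `v̲ ∤ l`, and `e ≤ e*_mod·l/2` contradicts `p − 2 < e`
    exfalso
    have hι' : 2 ^ 12 * 3 ^ 3 * 5 * emod * l < p := not_le.mp hι
    have hpl : p ≠ l := by
      rintro rfl
      exact hι (Nat.le_mul_of_pos_left p (by positivity))
    have h := hR2 hpl
    have h2 : 2 ^ 12 * 3 ^ 3 * 5 * emod * l = 2 * (2 ^ 11 * 3 ^ 3 * 5 * emod * l) := by ring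
    rw [h2] at hι'
    omega

end PlaceSection

end Literature.IUT.LogVolume

end

/-! ## Appendix (append-only): (R4) with a PER-PLACE bound on the middle layer

For the cell's MODEL READING v3 (abc-iut-plan 2026-08-26T02:33:05Z) the theta field is
`F‡ = F_tpd(√−1, √λ, √(λ−1), E_λ[3·5])`, whose DEGREE over `F_mod` may reach `6·2^12·3^2·5 = 2^13·3^3·5 > 2^11·3^3·5`,
so the degree hypothesis `hF` of `PlaceSection.R4_localFieldFamily` is not available. What (R4) actually consumes is a
bound on the RAMIFICATION INDEX `e(v̲ ∩ F | v)` of the middle layer at the one place in question: the crude bound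
`≤ 2^13·3^3·5` everywhere (degree) and print's budget `≤ 2^11·3^3·5` only at the primes `p > e*_mod·l` (all odd and
prime to `3·5·l`, where `√−1` and one of `√λ, √(λ−1), √(λ(λ−1))` are unramified, so the inertia of `F‡/F_tpd` has order
`≤ 2·|GL₂(𝔽₃)|·|GL₂(𝔽₅)| = 46080`). [cite: Mochizuki2012, IUTchIV Thm 1.10 proof Step (iii) (R1)–(R4) p.25–26] -/

namespace Literature.IUT.LogVolume

open NumberField IsDedekindDomain

/-- `21·(2^13·3^3·5·m·l^4) ≤ (2^12·3^3·5·m·l)^4` (the (R1)/(R4) numerics with the v3 degree budget `2^13·3^3·5`).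
[cite: Mochizuki2012, IUTchIV Thm 1.10 proof Step (iii) (R4) p.26] -/
theorem twentyOne_mul_R1_le_pow' (m l : ℕ) :
    21 * (2 ^ 13 * 3 ^ 3 * 5 * m * l ^ 4) ≤ (2 ^ 12 * 3 ^ 3 * 5 * m * l) ^ 4 := by
  have h1 : m ≤ m ^ 4 := Nat.le_self_pow (by norm_num) m
  calc 21 * (2 ^ 13 * 3 ^ 3 * 5 * m * l ^ 4) = (21 * (2 ^ 13 * 3 ^ 3 * 5)) * (m * l ^ 4) := by ring
    _ ≤ (2 ^ 12 * 3 ^ 3 * 5) ^ 4 * (m ^ 4 * l ^ 4) :=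
        Nat.mul_le_mul (by norm_num) (Nat.mul_le_mul_right _ h1)
    _ = (2 ^ 12 * 3 ^ 3 * 5 * m * l) ^ 4 := by ring

/-- `21·(2^13·3^3·5·m·l) ≤ (2^12·3^3·5·m·l)^4`. [cite: Mochizuki2012, IUTchIV Thm 1.10 proof Step (iii) (R4) p.26] -/
theorem twentyOne_mul_R2_le_pow' (m l : ℕ) :
    21 * (2 ^ 13 * 3 ^ 3 * 5 * m * l) ≤ (2 ^ 12 * 3 ^ 3 * 5 * m * l) ^ 4 := by
  have h : 2 ^ 13 * 3 ^ 3 * 5 * m * l ≤ 2 ^ 13 * 3 ^ 3 * 5 * m * l ^ 4 :=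
    Nat.mul_le_mul_left _ (Nat.le_self_pow (by norm_num) l)
  exact (Nat.mul_le_mul_left 21 h).trans (twentyOne_mul_R1_le_pow' m l)

section TowerPerPlace

variable {F₀ F K : Type} [Field F₀] [NumberField F₀] [Field F] [NumberField F] [Field K] [NumberField K]
  [Algebra F₀ F] [Algebra F K] [Algebra F₀ K] [IsScalarTower F₀ F K]

omit [NumberField K] in
/-- **The tower bound with a per-place middle layer**: `e(u ∩ F₀ | p) ≤ e_mod` and `e(u ∩ F | u ∩ F₀) ≤ D` give
`e(u | p) ≤ e_mod·D·e(u | u ∩ F)`. [cite: Mochizuki2012, IUTchIV Thm 1.10 proof Step (iii) (R1)–(R3) p.25] -/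
theorem ramificationIdx_int_le_of_under_le (u : HeightOneSpectrum (𝓞 K)) {emod D : ℕ}
    (hemod : (u.asIdeal.under (𝓞 F₀)).ramificationIdx ℤ ≤ emod)
    (hD : (u.asIdeal.under (𝓞 F)).ramificationIdx (𝓞 F₀) ≤ D) :
    u.asIdeal.ramificationIdx ℤ ≤ emod * D * u.asIdeal.ramificationIdx (𝓞 F) := by
  rw [ramificationIdx_int_eq_mul_mul (F₀ := F₀) (F := F) u, ← mul_assoc]
  exact Nat.mul_le_mul_right _ (Nat.mul_le_mul hemod hD)

end TowerPerPlace

namespace PlaceSection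

variable {F₀ K : Type} [Field F₀] [NumberField F₀] [Field K] [NumberField K] [Algebra F₀ K]
  (σ : PlaceSection F₀ K)
variable {F : Type} [Field F] [NumberField F] [Algebra F₀ F] [Algebra F K] [IsScalarTower F₀ F K]

/-- **(R4) for the genuine completions with a PER-PLACE middle-layer bound** (same conclusion as
`R4_localFieldFamily`, `e*_mod = 2^12·3^3·5·e_mod`): instead of `[F : F₀] ≤ 2^11·3^3·5` it suffices that the
ramification index `e(v̲ ∩ F | v)` of the middle layer is `≤ 2^13·3^3·5` (e.g. by degree, reading v3's `F‡`) and
`≤ 2^11·3^3·5` WHEN `p > e*_mod·l` (print's budget, needed only for the void branch `ι_p = 0`; those `p` are odd and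
prime to `3·5·l`). [cite: Mochizuki2012, IUTchIV Thm 1.10 proof Step (iii) (R4) p.26]
[cite: Mochizuki2012, IUTchIV Thm 1.10 proof Step (v) p.28] -/
theorem R4_localFieldFamily_of_ramificationIdx_le {p : ℕ} [hp : Fact p.Prime] (v : placesOver F₀ p) {emod l : ℕ}
    (hemod1 : 1 ≤ emod) (hemod : v.1.asIdeal.ramificationIdx ℤ ≤ emod)
    (hFcrude : ((σ.lift v.1).asIdeal.under (𝓞 F)).ramificationIdx (𝓞 F₀) ≤ 2 ^ 13 * 3 ^ 3 * 5)
    (hFodd : 2 ^ 12 * 3 ^ 3 * 5 * emod * l < p →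
      ((σ.lift v.1).asIdeal.under (𝓞 F)).ramificationIdx (𝓞 F₀) ≤ 2 ^ 11 * 3 ^ 3 * 5)
    (hl : l.Prime) (hKF : Module.finrank F K ∣ l * (l - 1) ^ 2 * (l + 1))
    (htame : ((l : ℕ) : 𝓞 F) ∉ (σ.lift v.1).asIdeal.under (𝓞 F) →
      (σ.lift v.1).asIdeal.ramificationIdx (𝓞 F) ∣ l) :
    p - 2 < absRamificationIdx p ((σ.localFieldFamily p hp.out).k v) →
      3 + Real.log (absRamificationIdx p ((σ.localFieldFamily p hp.out).k v)) ≤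
        4 * (if p ≤ 2 ^ 12 * 3 ^ 3 * 5 * emod * l then (1 : ℝ) else 0) *
          Real.log (((2 ^ 12 * 3 ^ 3 * 5 * emod : ℕ) : ℝ) * l) := by
  intro hlt
  have hcast : (((2 ^ 12 * 3 ^ 3 * 5 * emod : ℕ) : ℝ) * l) = ((2 ^ 12 * 3 ^ 3 * 5 * emod * l : ℕ) : ℝ) := by
    push_cast; ring
  rw [hcast]
  rw [σ.absRamificationIdx_localFieldFamily_eq v] at hlt ⊢
  set u : HeightOneSpectrum (𝓞 K) := σ.lift v.1 with hu
  have hemod' : (u.asIdeal.under (𝓞 F₀)).ramificationIdx ℤ ≤ emod := by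
    rw [hu, σ.ramificationIdx_under_lift_eq v.1]; exact hemod
  have he1 : 1 ≤ u.asIdeal.ramificationIdx ℤ := Ideal.ramificationIdx_pos _ _
  have hpu : ((p : ℕ) : 𝓞 K) ∈ u.asIdeal := σ.natCast_mem_lift v
  -- `e(u | u ∩ F) ≤ l^4` always, `∣ l` off `l`
  have hK4 : u.asIdeal.ramificationIdx (𝓞 F) ≤ l ^ 4 := by
    refine (ramificationIdx_rel_le_finrank u).trans ((Nat.le_of_dvd ?_ hKF).trans (card_GL_two_le_pow_four l))
    have h1 : 0 < l - 1 := by have := hl.two_le; omega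
    exact Nat.mul_pos (Nat.mul_pos hl.pos (pow_pos h1 2)) (Nat.succ_pos l)
  have hKl : p ≠ l → u.asIdeal.ramificationIdx (𝓞 F) ≤ l := fun hne =>
    Nat.le_of_dvd hl.pos (htame (natCast_not_mem_under_of_ne (F := F) u hp.out hl hpu hne))
  by_cases hι : p ≤ 2 ^ 12 * 3 ^ 3 * 5 * emod * l
  · -- `ι_p = 1`: the crude middle-layer bound suffices
    rw [if_pos hι, mul_one]
    refine three_add_log_le_four_mul_log he1 ?_
    have hbase := ramificationIdx_int_le_of_under_le (F₀ := F₀) (F := F) u hemod' hFcrude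
    by_cases hpl : p = l
    · have h : u.asIdeal.ramificationIdx ℤ ≤ 2 ^ 13 * 3 ^ 3 * 5 * emod * l ^ 4 :=
        calc u.asIdeal.ramificationIdx ℤ ≤ emod * (2 ^ 13 * 3 ^ 3 * 5) * u.asIdeal.ramificationIdx (𝓞 F) := hbase
          _ ≤ emod * (2 ^ 13 * 3 ^ 3 * 5) * l ^ 4 := Nat.mul_le_mul_left _ hK4
          _ = 2 ^ 13 * 3 ^ 3 * 5 * emod * l ^ 4 := by ring
      exact (Nat.mul_le_mul_left 21 h).trans (twentyOne_mul_R1_le_pow' emod l)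
    · have h : u.asIdeal.ramificationIdx ℤ ≤ 2 ^ 13 * 3 ^ 3 * 5 * emod * l :=
        calc u.asIdeal.ramificationIdx ℤ ≤ emod * (2 ^ 13 * 3 ^ 3 * 5) * u.asIdeal.ramificationIdx (𝓞 F) := hbase
          _ ≤ emod * (2 ^ 13 * 3 ^ 3 * 5) * l := Nat.mul_le_mul_left _ (hKl hpl)
          _ = 2 ^ 13 * 3 ^ 3 * 5 * emod * l := by ring
      exact (Nat.mul_le_mul_left 21 h).trans (twentyOne_mul_R2_le_pow' emod l)
  · -- `ι_p = 0`: print's budget at the (odd, tame) prime `p > e*_mod·l`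
    exfalso
    have hι' : 2 ^ 12 * 3 ^ 3 * 5 * emod * l < p := not_le.mp hι
    have hpl : p ≠ l := by
      rintro rfl
      exact hι (Nat.le_mul_of_pos_left p (by positivity))
    have h : u.asIdeal.ramificationIdx ℤ ≤ 2 ^ 11 * 3 ^ 3 * 5 * emod * l :=
      calc u.asIdeal.ramificationIdx ℤ ≤ emod * (2 ^ 11 * 3 ^ 3 * 5) * u.asIdeal.ramificationIdx (𝓞 F) :=
            ramificationIdx_int_le_of_under_le (F₀ := F₀) (F := F) u hemod' (hFodd hι')
        _ ≤ emod * (2 ^ 11 * 3 ^ 3 * 5) * l := Nat.mul_le_mul_left _ (hKl hpl)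
        _ = 2 ^ 11 * 3 ^ 3 * 5 * emod * l := by ring
    have h2 : 2 ^ 12 * 3 ^ 3 * 5 * emod * l = 2 * (2 ^ 11 * 3 ^ 3 * 5 * emod * l) := by ring
    rw [h2] at hι'
    omega

end PlaceSection

end Literature.IUT.LogVolume

/-! ## Appendix 2 (append-only): (R4) with PARAMETRIC constants

The same argument with the three constants made explicit — `N` (print's `e*_mod`: both the `ι`-threshold `N·l` and the
argument of `l*_mod = log(N·l)`), `B` (the middle-layer ramification budget USED in the void branch `p > N·l`) and `C`
(the crude budget used when `p ≤ N·l`) — subject only to the two numeric conditions the proof consumes: `2·B·e_mod ≤ N`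
(void branch: `e ≤ e_mod·B·l ≤ N·l/2 < p − 2`) and `21·e_mod·C ≤ N^4` (`21·e ≤ (N·l)^4`). Print: `(N, B, C) =
(2^12·3^3·5·e_mod, 2^11·3^3·5, 2^11·3^3·5)`; the cell's reading v3 can take `B = 2^11·3^3·5` (two unramified square roots
at the odd tame primes), or `N = 2^13·3^3·5·e_mod, B = 2^12·3^3·5` (one), or `N = 2^14·3^3·5·e_mod, B = C =
2^13·3^3·5 = [F‡ : F_mod]`-budget (degrees only) — the route's constant is the cell's to choose (plan 2026-08-26T02:33:05Z).
[cite: Mochizuki2012, IUTchIV Thm 1.10 proof Step (iii) (R1)–(R4) p.25–26] -/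

namespace Literature.IUT.LogVolume

open NumberField IsDedekindDomain

namespace PlaceSection

variable {F₀ K : Type} [Field F₀] [NumberField F₀] [Field K] [NumberField K] [Algebra F₀ K]
  (σ : PlaceSection F₀ K)
variable {F : Type} [Field F] [NumberField F] [Algebra F₀ F] [Algebra F K] [IsScalarTower F₀ F K]

/-- **(R4) for the genuine completions, parametric constants** `N` (`= e*_mod`), `B` (void-branch middle-layer budget),
`C` (crude middle-layer budget), under `2·B·e_mod ≤ N` and `21·e_mod·C ≤ N^4`: with the per-place middle-layer bounds
`e(v̲ ∩ F | v) ≤ C` and (`p > N·l ⇒`) `e(v̲ ∩ F | v) ≤ B`, the Prop. 1.8 (vii) input off `l` and `[K:F] ∣ l(l−1)²(l+1)`: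
`p − 2 < e(K_{v̲}) ⟹ 3 + log e(K_{v̲}) ≤ 4·ι_p·log(N·l)`, `ι_p = (p ≤ N·l ? 1 : 0)`.
[cite: Mochizuki2012, IUTchIV Thm 1.10 proof Step (iii) (R4) p.26] [cite: Mochizuki2012, IUTchIV Thm 1.10 proof Step (v) p.28] -/
theorem R4_localFieldFamily_param {p : ℕ} [hp : Fact p.Prime] (v : placesOver F₀ p) {emod l N B C : ℕ}
    (hNB : 2 * B * emod ≤ N) (hNC : 21 * emod * C ≤ N ^ 4)
    (hemod : v.1.asIdeal.ramificationIdx ℤ ≤ emod)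
    (hFcrude : ((σ.lift v.1).asIdeal.under (𝓞 F)).ramificationIdx (𝓞 F₀) ≤ C)
    (hFbig : N * l < p → ((σ.lift v.1).asIdeal.under (𝓞 F)).ramificationIdx (𝓞 F₀) ≤ B)
    (hl : l.Prime) (hKF : Module.finrank F K ∣ l * (l - 1) ^ 2 * (l + 1))
    (htame : ((l : ℕ) : 𝓞 F) ∉ (σ.lift v.1).asIdeal.under (𝓞 F) →
      (σ.lift v.1).asIdeal.ramificationIdx (𝓞 F) ∣ l) :
    p - 2 < absRamificationIdx p ((σ.localFieldFamily p hp.out).k v) →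
      3 + Real.log (absRamificationIdx p ((σ.localFieldFamily p hp.out).k v)) ≤
        4 * (if p ≤ N * l then (1 : ℝ) else 0) * Real.log ((N : ℝ) * l) := by
  intro hlt
  have hcast : ((N : ℝ) * l) = ((N * l : ℕ) : ℝ) := by push_cast; ring
  rw [hcast]
  rw [σ.absRamificationIdx_localFieldFamily_eq v] at hlt ⊢
  set u : HeightOneSpectrum (𝓞 K) := σ.lift v.1 with hu
  have hemod' : (u.asIdeal.under (𝓞 F₀)).ramificationIdx ℤ ≤ emod := by
    rw [hu, σ.ramificationIdx_under_lift_eq v.1]; exact hemod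
  have he1 : 1 ≤ u.asIdeal.ramificationIdx ℤ := Ideal.ramificationIdx_pos _ _
  have hpu : ((p : ℕ) : 𝓞 K) ∈ u.asIdeal := σ.natCast_mem_lift v
  have hK4 : u.asIdeal.ramificationIdx (𝓞 F) ≤ l ^ 4 := by
    refine (ramificationIdx_rel_le_finrank u).trans ((Nat.le_of_dvd ?_ hKF).trans (card_GL_two_le_pow_four l))
    have h1 : 0 < l - 1 := by have := hl.two_le; omega
    exact Nat.mul_pos (Nat.mul_pos hl.pos (pow_pos h1 2)) (Nat.succ_pos l)
  have hKl : p ≠ l → u.asIdeal.ramificationIdx (𝓞 F) ≤ l := fun hne =>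
    Nat.le_of_dvd hl.pos (htame (natCast_not_mem_under_of_ne (F := F) u hp.out hl hpu hne))
  -- the crude bound `e ≤ e_mod·C·(l^4 or l) ≤ e_mod·C·l^4`
  have hcrude : u.asIdeal.ramificationIdx ℤ ≤ emod * C * l ^ 4 := by
    have hbase := ramificationIdx_int_le_of_under_le (F₀ := F₀) (F := F) u hemod' hFcrude
    exact hbase.trans (Nat.mul_le_mul_left _ hK4)
  by_cases hι : p ≤ N * l
  · rw [if_pos hι, mul_one]
    refine three_add_log_le_four_mul_log he1 ?_
    calc 21 * u.asIdeal.ramificationIdx ℤ ≤ 21 * (emod * C * l ^ 4) := Nat.mul_le_mul_left 21 hcrude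
      _ = (21 * emod * C) * l ^ 4 := by ring
      _ ≤ N ^ 4 * l ^ 4 := Nat.mul_le_mul_right _ hNC
      _ = (N * l) ^ 4 := by ring
  · exfalso
    have hι' : N * l < p := not_le.mp hι
    -- `p ≠ l`: else `l > N·l ≥ 2·B·e_mod·l`, forcing `B·e_mod = 0`, which contradicts `e ≥ 1` below anyway
    have hB : u.asIdeal.ramificationIdx ℤ ≤ emod * B * u.asIdeal.ramificationIdx (𝓞 F) :=
      ramificationIdx_int_le_of_under_le (F₀ := F₀) (F := F) u hemod' (hFbig hι')
    by_cases hpl : p = l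
    · -- then `N < 1`, so `N = 0`, so `2·B·e_mod = 0`, so `e ≤ 0`: contradiction with `e ≥ 1`
      subst hpl
      have hN0 : N = 0 := by
        by_contra h
        have : p ≤ N * p := Nat.le_mul_of_pos_left p (Nat.pos_of_ne_zero h)
        omega
      subst hN0
      have hBe : B * emod = 0 := by
        have h2 : 2 * (B * emod) ≤ 0 := by rw [← mul_assoc]; exact hNB
        omega
      have : u.asIdeal.ramificationIdx ℤ ≤ 0 := by
        calc u.asIdeal.ramificationIdx ℤ ≤ emod * B * u.asIdeal.ramificationIdx (𝓞 F) := hB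
          _ = (B * emod) * u.asIdeal.ramificationIdx (𝓞 F) := by ring
          _ = 0 := by rw [hBe, zero_mul]
      omega
    · have h : u.asIdeal.ramificationIdx ℤ ≤ emod * B * l := hB.trans (Nat.mul_le_mul_left _ (hKl hpl))
      -- `2·e ≤ 2·B·e_mod·l ≤ N·l < p`, so `e ≤ p − 2` unless `e = 0`
      have h2 : 2 * u.asIdeal.ramificationIdx ℤ ≤ N * l := by
        calc 2 * u.asIdeal.ramificationIdx ℤ ≤ 2 * (emod * B * l) := Nat.mul_le_mul_left 2 h
          _ = (2 * B * emod) * l := by ring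
          _ ≤ N * l := Nat.mul_le_mul_right _ hNB
      omega

/-- The constants of `R4_localFieldFamily` ARE an instance of the parametric form: `N = 2^12·3^3·5·e_mod`,
`B = 2^11·3^3·5`, `C = 2^13·3^3·5` satisfy `2·B·e_mod ≤ N` and `21·e_mod·C ≤ N^4`.
[cite: Mochizuki2012, IUTchIV Thm 1.10 proof Step (iii) (R4) p.26] -/
theorem R4_constants_print (emod : ℕ) :
    2 * (2 ^ 11 * 3 ^ 3 * 5) * emod ≤ 2 ^ 12 * 3 ^ 3 * 5 * emod ∧
      21 * emod * (2 ^ 13 * 3 ^ 3 * 5) ≤ (2 ^ 12 * 3 ^ 3 * 5 * emod) ^ 4 := by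
  refine ⟨by ring_nf; exact le_rfl, ?_⟩
  have h1 : emod ≤ emod ^ 4 := Nat.le_self_pow (by norm_num) emod
  calc 21 * emod * (2 ^ 13 * 3 ^ 3 * 5) = (21 * (2 ^ 13 * 3 ^ 3 * 5)) * emod := by ring
    _ ≤ (2 ^ 12 * 3 ^ 3 * 5) ^ 4 * emod ^ 4 := Nat.mul_le_mul (by norm_num) h1
    _ = (2 ^ 12 * 3 ^ 3 * 5 * emod) ^ 4 := by ring

/-- The DEGREES-ONLY constants for the cell's reading v3 (`[F‡ : F_mod] ≤ 2^13·3^3·5`): `N = 2^14·3^3·5·e_mod`,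
`B = C = 2^13·3^3·5` satisfy the two conditions — so with `e*_mod := 2^14·3^3·5·e_mod` (R4) needs no per-place input
beyond the degree. [cite: Mochizuki2012, IUTchIV Thm 1.10 proof Step (iii) (R4) p.26] -/
theorem R4_constants_degreeOnly (emod : ℕ) :
    2 * (2 ^ 13 * 3 ^ 3 * 5) * emod ≤ 2 ^ 14 * 3 ^ 3 * 5 * emod ∧
      21 * emod * (2 ^ 13 * 3 ^ 3 * 5) ≤ (2 ^ 14 * 3 ^ 3 * 5 * emod) ^ 4 := by
  refine ⟨by ring_nf; exact le_rfl, ?_⟩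
  have h1 : emod ≤ emod ^ 4 := Nat.le_self_pow (by norm_num) emod
  calc 21 * emod * (2 ^ 13 * 3 ^ 3 * 5) = (21 * (2 ^ 13 * 3 ^ 3 * 5)) * emod := by ring
    _ ≤ (2 ^ 14 * 3 ^ 3 * 5) ^ 4 * emod ^ 4 := Nat.mul_le_mul (by norm_num) h1
    _ = (2 ^ 14 * 3 ^ 3 * 5 * emod) ^ 4 := by ring

/-- The ONE-SQUARE-ROOT constants for reading v3 (`√−1` unramified at odd places: middle-layer index
`≤ 2^12·3^2·5·6/2·… = 2^12·3^3·5` there): `N = 2^13·3^3·5·e_mod`, `B = 2^12·3^3·5`, `C = 2^13·3^3·5`.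
[cite: Mochizuki2012, IUTchIV Thm 1.10 proof Step (iii) (R4) p.26] -/
theorem R4_constants_oneRoot (emod : ℕ) :
    2 * (2 ^ 12 * 3 ^ 3 * 5) * emod ≤ 2 ^ 13 * 3 ^ 3 * 5 * emod ∧
      21 * emod * (2 ^ 13 * 3 ^ 3 * 5) ≤ (2 ^ 13 * 3 ^ 3 * 5 * emod) ^ 4 := by
  refine ⟨by ring_nf; exact le_rfl, ?_⟩
  have h1 : emod ≤ emod ^ 4 := Nat.le_self_pow (by norm_num) emod
  calc 21 * emod * (2 ^ 13 * 3 ^ 3 * 5) = (21 * (2 ^ 13 * 3 ^ 3 * 5)) * emod := by ring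
    _ ≤ (2 ^ 13 * 3 ^ 3 * 5) ^ 4 * emod ^ 4 := Nat.mul_le_mul (by norm_num) h1
    _ = (2 ^ 13 * 3 ^ 3 * 5 * emod) ^ 4 := by ring

end PlaceSection

end Literature.IUT.LogVolume

/-! ## Appendix 3 (append-only): (R4) from the ABSOLUTE ramification index of the middle place

The form consumed at a genuine Θ-volume datum of the cell's reading v3: the base field `F₀` enters only through the
section of places; the middle layer `F` (the theta field) enters through the ABSOLUTE index `e(v̲ ∩ F | p)` of its
place under `v̲` — crude budget `Mc` everywhere (`21·Mc ≤ N^4`), void-branch budget `Mb` (`2·Mb ≤ N`) only at the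
primes `p > N·l`. For [IUTchIV]'s constants `N = e*_mod = 2^12·3^3·5·e_mod`, `Mb = 2^11·3^3·5·e_mod` (print p. 25–26:
`e_v ≤ 2^11·3^3·5·e_mod·l` at `v ∤ l` is `e(v̲∩F|p)·e(v̲|v̲∩F) ≤ Mb·l`). [cite: Mochizuki2012, IUTchIV Thm 1.10 proof Step (iii) (R1)–(R4) p.25–26] -/

namespace Literature.IUT.LogVolume

open NumberField IsDedekindDomain

namespace PlaceSection

variable {F₀ K : Type} [Field F₀] [NumberField F₀] [Field K] [NumberField K] [Algebra F₀ K]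
  (σ : PlaceSection F₀ K)
variable {F : Type} [Field F] [NumberField F] [Algebra F K]

/-- **(R4) for the genuine completions from the ABSOLUTE index of the middle place**: for a number field `F` with
`K ⊇ F`, constants `N, Mb, Mc` with `2·Mb ≤ N`, `21·Mc ≤ N^4`, the bounds `e(v̲ ∩ F | p) ≤ Mc` and
(`p > N·l ⇒`) `e(v̲ ∩ F | p) ≤ Mb`, the Prop. 1.8 (vii) input `e(v̲ | v̲ ∩ F) ∣ l` off `l` and `[K:F] ∣ l(l−1)²(l+1)`:
`p − 2 < e(K_{v̲}) ⟹ 3 + log e(K_{v̲}) ≤ 4·ι_p·log(N·l)`, `ι_p = (p ≤ N·l ? 1 : 0)`.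
[cite: Mochizuki2012, IUTchIV Thm 1.10 proof Step (iii) (R4) p.26] [cite: Mochizuki2012, IUTchIV Thm 1.10 proof Step (v) p.28] -/
theorem R4_localFieldFamily_abs {p : ℕ} [hp : Fact p.Prime] (v : placesOver F₀ p) {l N Mb Mc : ℕ}
    (hNb : 2 * Mb ≤ N) (hNc : 21 * Mc ≤ N ^ 4)
    (hcrude : ((σ.lift v.1).asIdeal.under (𝓞 F)).ramificationIdx ℤ ≤ Mc)
    (hbig : N * l < p → ((σ.lift v.1).asIdeal.under (𝓞 F)).ramificationIdx ℤ ≤ Mb)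
    (hl : l.Prime) (hKF : Module.finrank F K ∣ l * (l - 1) ^ 2 * (l + 1))
    (htame : ((l : ℕ) : 𝓞 F) ∉ (σ.lift v.1).asIdeal.under (𝓞 F) →
      (σ.lift v.1).asIdeal.ramificationIdx (𝓞 F) ∣ l) :
    p - 2 < absRamificationIdx p ((σ.localFieldFamily p hp.out).k v) →
      3 + Real.log (absRamificationIdx p ((σ.localFieldFamily p hp.out).k v)) ≤
        4 * (if p ≤ N * l then (1 : ℝ) else 0) * Real.log ((N : ℝ) * l) := by
  intro hlt
  have hcast : ((N : ℝ) * l) = ((N * l : ℕ) : ℝ) := by push_cast; ring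
  rw [hcast]
  rw [σ.absRamificationIdx_localFieldFamily_eq v] at hlt ⊢
  set u : HeightOneSpectrum (𝓞 K) := σ.lift v.1 with hu
  have he1 : 1 ≤ u.asIdeal.ramificationIdx ℤ := Ideal.ramificationIdx_pos _ _
  have hpu : ((p : ℕ) : 𝓞 K) ∈ u.asIdeal := σ.natCast_mem_lift v
  -- one tower step: `e(u | p) = e(u ∩ F | p) · e(u | u ∩ F)`
  have htower : u.asIdeal.ramificationIdx ℤ =
      (u.asIdeal.under (𝓞 F)).ramificationIdx ℤ * u.asIdeal.ramificationIdx (𝓞 F) :=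
    Ideal.ramificationIdx_tower (R := ℤ) (u.asIdeal.under (𝓞 F)) u.asIdeal
  have hK4 : u.asIdeal.ramificationIdx (𝓞 F) ≤ l ^ 4 := by
    refine (ramificationIdx_rel_le_finrank u).trans ((Nat.le_of_dvd ?_ hKF).trans (card_GL_two_le_pow_four l))
    have h1 : 0 < l - 1 := by have := hl.two_le; omega
    exact Nat.mul_pos (Nat.mul_pos hl.pos (pow_pos h1 2)) (Nat.succ_pos l)
  have hKl : p ≠ l → u.asIdeal.ramificationIdx (𝓞 F) ≤ l := fun hne =>
    Nat.le_of_dvd hl.pos (htame (natCast_not_mem_under_of_ne (F := F) u hp.out hl hpu hne))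
  by_cases hι : p ≤ N * l
  · rw [if_pos hι, mul_one]
    refine three_add_log_le_four_mul_log he1 ?_
    calc 21 * u.asIdeal.ramificationIdx ℤ
        = 21 * ((u.asIdeal.under (𝓞 F)).ramificationIdx ℤ * u.asIdeal.ramificationIdx (𝓞 F)) := by
          rw [htower]
      _ ≤ 21 * (Mc * l ^ 4) := Nat.mul_le_mul_left 21 (Nat.mul_le_mul hcrude hK4)
      _ = (21 * Mc) * l ^ 4 := by ring
      _ ≤ N ^ 4 * l ^ 4 := Nat.mul_le_mul_right _ hNc
      _ = (N * l) ^ 4 := by ring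
  · exfalso
    have hι' : N * l < p := not_le.mp hι
    by_cases hpl : p = l
    · -- `l > N·l` forces `N = 0`, so `Mb = 0`, so `e(u ∩ F | p) = 0`: contradiction with `e ≥ 1`
      subst hpl
      have hN0 : N = 0 := by
        by_contra h
        have : p ≤ N * p := Nat.le_mul_of_pos_left p (Nat.pos_of_ne_zero h)
        omega
      subst hN0
      have hMb : Mb = 0 := by omega
      have h0 : (u.asIdeal.under (𝓞 F)).ramificationIdx ℤ = 0 := by
        have := hbig hι'; rw [hMb] at this; omega
      rw [htower, h0, zero_mul] at he1
      omega
    · have h : u.asIdeal.ramificationIdx ℤ ≤ Mb * l := by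
        rw [htower]; exact Nat.mul_le_mul (hbig hι') (hKl hpl)
      have h2 : 2 * u.asIdeal.ramificationIdx ℤ ≤ N * l := by
        calc 2 * u.asIdeal.ramificationIdx ℤ ≤ 2 * (Mb * l) := Nat.mul_le_mul_left 2 h
          _ = (2 * Mb) * l := by ring
          _ ≤ N * l := Nat.mul_le_mul_right _ hNb
      omega

end PlaceSection

end Literature.IUT.LogVolume
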